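import Summits.Ventures.YMGap.Census.FieldRP
import HarnessLib

/-!
# Venture YMGap, track (b) — switching off the plaquettes outside a reflection-transportable pattern does not increase
# `Z_Λ({c_j})` (the monotonicity step of Tomboulis's App. A §1, for every even torus and every spin cut-off)

HONEST FRAMING: venture file of the cell `pub-ymgap` (QuantumFields programme), track (b); finite tori `(ℤ/Lℤ)^d`, `L` even;
nothing about (5.15), limits, confinement or a mass gap.

Tomboulis, arXiv:0707.2179, App. A §1 proves Prop. II.1 (ii) (eq. (2.13)) by DROPPING plaquettes ("all non-negative by
reflection positivity") until the lattice falls apart into unit hypercubes.  Kernel form of the dropping step, organised so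
that it works on every even torus (not only side lengths `2^m`): for a set `S` of plaquettes and `t ∈ [0, 1]` let
`Z_S(t) = ∫ ∏_{p ∈ S} f_c(U_p) ∏_{p ∉ S} f_{t c}(U_p) dU` (`patternField`; `f_{tc} = 1 + t (f_c - 1)`), so that `Z_S(1) = Z_Λ({c_j})`
and `Z_S(0) = ∫ ∏_{p ∈ S} f_c(U_p) dU`.  Then `d/dt Z_S(t) = Σ_{p₀ ∉ S} ∫ (f_c - 1)(U_{p₀}) ∏_{p ≠ p₀} (…) dU`
(`hasDerivAt_coefFieldZ_pattern`, differentiation under the integral sign as in `CoeffMonotone`), and every term is `≥ 0`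
by `FieldRP.coefFieldZ_nonneg` PROVIDED `p₀` can be carried onto the reflection hyperplane by a lattice symmetry under which
the pulled-back pattern is still reflection invariant (`IsReflTransportable S`; the cube patterns of `CubePattern` are such,
`cubePattern_transport`).  Hence **`coefFieldZ_pattern_le_torusZ`**: `Z_S(0) ≤ Z_Λ({c_j})` for `c_j ≥ 0`.

## Main statements (namespace `Summit.Ventures.YMGap.Census`)

* `gCoef c` (`f_c - 1`), `oneCoef` (`1`), `patternField c S t`, `basePatternField c S` (`= patternField c S 0`).
* `IsReflTransportable S`; `coefFieldZ_marked_nonneg`; `hasDerivAt_coefFieldZ_pattern`.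
* **`coefFieldZ_pattern_le_torusZ`** — `L` even, `c_j ≥ 0`, `S` reflection-transportable ⟹
  `coefFieldZ J (basePatternField c S) ≤ torusZ d L J c`.

References: E. T. Tomboulis, arXiv:0707.2179, Prop. II.1 (ii) eq. (2.13), App. A §1 (A.1)–(A.4)
[cite: Tomboulis2007Confinement, App. A §1]; K. Osterwalder, E. Seiler, Ann. Phys. 110 (1978) 440, §2
[cite: OsterwalderSeilerAnnPhys1978, §2].
-/

noncomputable section

open MeasureTheory Finset Real
open scoped BigOperators
open Literature.MathematicalPhysics.QuantumLattice
open Literature.MathematicalPhysics.QuantumFieldTheory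
open Literature.MathematicalPhysics.QuantumFieldTheory.Tomboulis2007
open Literature.MathematicalPhysics.QuantumFieldTheory.WilsonRP

namespace Summit.Ventures.YMGap.Census

variable {d L : ℕ}

/-! ### Coefficient vectors and the interpolating field -/

/-- The coefficients of `f_c - 1 = Σ_{j ≠ 0} d_j c_j χ_j` (`n = 0 ↦ 0`, `n ↦ (n+1) c_n`). -/
def gCoef (c : ℕ → ℝ) (n : ℕ) : ℝ :=
  if n = 0 then 0 else ((n : ℝ) + 1) * c n

/-- The coefficients of the trivial weight `1`. -/
def oneCoef (n : ℕ) : ℝ :=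
  if n = 0 then 1 else 0

/-- `gCoef c ≥ 0` when `c_j ≥ 0`. -/
theorem gCoef_nonneg {c : ℕ → ℝ} (hc : ∀ n, 1 ≤ n → 0 ≤ c n) (n : ℕ) : 0 ≤ gCoef c n := by
  unfold gCoef
  split_ifs with h0
  · exact le_rfl
  · exact mul_nonneg (by positivity) (hc n (Nat.one_le_iff_ne_zero.mpr h0))

/-- `charSum J (gCoef c) r = f_c(r) - 1`. -/
theorem charSum_gCoef (J : ℕ) (c : ℕ → ℝ) (r : ℝ) : charSum J (gCoef c) r = fR J c r - 1 := by
  unfold charSum fR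
  rw [sum_range_succ_eq_add_sum_Icc]
  have h0 : gCoef c 0 * charR 0 r = 0 := by simp [gCoef]
  rw [h0, zero_add]
  have h : ∑ n ∈ Icc 1 J, gCoef c n * charR n r = ∑ n ∈ Icc 1 J, ((n : ℝ) + 1) * c n * charR n r :=
    Finset.sum_congr rfl fun n hn => by
      have hn0 : n ≠ 0 := by have := (Finset.mem_Icc.1 hn).1; omega
      simp [gCoef, hn0]
  rw [h]
  ring

/-- `charSum J 0 r = 0`. -/
theorem charSum_zero (J : ℕ) (r : ℝ) : charSum J 0 r = 0 := by
  simp [charSum]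

/-- `stdCoef (t c) = oneCoef` at `t = 0`. -/
theorem stdCoef_scaleCoeff_zero (c : ℕ → ℝ) : stdCoef (scaleCoeff 0 c) = oneCoef := by
  funext n
  simp [stdCoef, scaleCoeff, oneCoef]

/-- `scaleCoeff 1 c = c`. -/
theorem scaleCoeff_one (c : ℕ → ℝ) : scaleCoeff 1 c = c := by
  funext n
  simp [scaleCoeff]

/-- `f_{tc}(r) = 1 + t (f_c(r) - 1)`. -/
theorem fR_scaleCoeff (J : ℕ) (c : ℕ → ℝ) (t r : ℝ) : fR J (scaleCoeff t c) r = 1 + t * (fR J c r - 1) := by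
  unfold fR scaleCoeff
  rw [add_sub_cancel_left, Finset.mul_sum]
  congr 1
  exact Finset.sum_congr rfl fun n _ => by ring

/-- **The interpolating field**: `f_c` on `S`, `f_{t c}` off `S`. -/
def patternField (c : ℕ → ℝ) (S : Finset (Plaquette d L)) (t : ℝ) : Plaquette d L → ℕ → ℝ :=
  fun p => if p ∈ S then stdCoef c else stdCoef (scaleCoeff t c)

/-- **The pattern field**: `f_c` on `S`, the trivial weight `1` off `S`. -/
def basePatternField (c : ℕ → ℝ) (S : Finset (Plaquette d L)) : Plaquette d L → ℕ → ℝ :=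
  fun p => if p ∈ S then stdCoef c else oneCoef

/-- `patternField c S 0 = basePatternField c S`. -/
theorem patternField_zero (c : ℕ → ℝ) (S : Finset (Plaquette d L)) : patternField c S 0 = basePatternField c S := by
  funext p
  simp only [patternField, basePatternField, stdCoef_scaleCoeff_zero]

/-- `Z(patternField c S 1) = Z_Λ({c_j})`. -/
theorem coefFieldZ_patternField_one [NeZero L] (J : ℕ) (c : ℕ → ℝ) (S : Finset (Plaquette d L)) :
    coefFieldZ J (patternField c S 1) = torusZ d L J c := by
  rw [torusZ_eq_coefFieldZ]
  congr 1
  funext p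
  simp only [patternField, scaleCoeff_one, ite_self]

/-- The marked field of the `p₀`-term of the derivative: the interpolating field with the factor of `p₀` replaced by
`f_c - 1` (off `S`) or by `0` (on `S`). -/
def markedField (c : ℕ → ℝ) (S : Finset (Plaquette d L)) (t : ℝ) (p₀ : Plaquette d L) : Plaquette d L → ℕ → ℝ :=
  Function.update (patternField c S t) p₀ (if p₀ ∈ S then 0 else gCoef c)

/-! ### The integrand of `Z_S(t)` and its derivative -/

section Marked

variable [NeZero d] [NeZero L] [Fact (1 < L)]

/-- The constant part of the factor of `p`: `f_c(U_p)` on `S`, `1` off `S`. -/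
def aP (J : ℕ) (c : ℕ → ℝ) (S : Finset (Plaquette d L)) (p : Plaquette d L) (W : GaugeConfig d L SU2) : ℝ :=
  if p ∈ S then fR J c (plaqRe rhoFund W p) else 1

/-- The `t`-coefficient of the factor of `p`: `0` on `S`, `f_c(U_p) - 1` off `S`. -/
def bP (J : ℕ) (c : ℕ → ℝ) (S : Finset (Plaquette d L)) (p : Plaquette d L) (W : GaugeConfig d L SU2) : ℝ :=
  if p ∈ S then 0 else fR J c (plaqRe rhoFund W p) - 1

omit [NeZero d] [NeZero L] [Fact (1 < L)] in
/-- The factor of `p` in the integrand of `Z_S(t)` is affine in `t`. -/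
theorem charSum_patternField (J : ℕ) (c : ℕ → ℝ) (S : Finset (Plaquette d L)) (t : ℝ) (p : Plaquette d L)
    (W : GaugeConfig d L SU2) :
    charSum J (patternField c S t p) (plaqRe rhoFund W p) = aP J c S p W + t * bP J c S p W := by
  unfold patternField aP bP
  split_ifs with hp
  · rw [charSum_stdCoef]; ring
  · rw [charSum_stdCoef, fR_scaleCoeff]

omit [NeZero d] [NeZero L] [Fact (1 < L)] in
/-- The factor of the marked plaquette. -/
theorem charSum_markedField_self (J : ℕ) (c : ℕ → ℝ) (S : Finset (Plaquette d L)) (t : ℝ) (p₀ : Plaquette d L)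
    (W : GaugeConfig d L SU2) :
    charSum J (markedField c S t p₀ p₀) (plaqRe rhoFund W p₀) = bP J c S p₀ W := by
  unfold markedField bP
  rw [Function.update_self]
  split_ifs
  · exact charSum_zero J _
  · exact charSum_gCoef J c _

/-- The integrand of `Z_S(t)`. -/
def lineFnP (J : ℕ) (c : ℕ → ℝ) (S : Finset (Plaquette d L)) (t : ℝ) (W : GaugeConfig d L SU2) : ℝ :=
  ∏ p : Plaquette d L, (aP J c S p W + t * bP J c S p W)

/-- Its `t`-derivative. -/
def dIntegrandP (J : ℕ) (c : ℕ → ℝ) (S : Finset (Plaquette d L)) (t : ℝ) (W : GaugeConfig d L SU2) : ℝ :=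
  ∑ p₀ : Plaquette d L, (∏ p ∈ univ.erase p₀, (aP J c S p W + t * bP J c S p W)) * bP J c S p₀ W

omit [NeZero d] [Fact (1 < L)] in
/-- `Z_S(t) = ∫ lineFnP t`. -/
theorem coefFieldZ_patternField_eq (J : ℕ) (c : ℕ → ℝ) (S : Finset (Plaquette d L)) (t : ℝ) :
    coefFieldZ J (patternField c S t) = ∫ W, lineFnP J c S t W ∂(Measure.pi fun _ : Edge d L => haarProbability SU2) := by
  unfold coefFieldZ coefFieldFn lineFnP
  exact integral_congr_ae (ae_of_all _ fun W => Finset.prod_congr rfl fun p _ => charSum_patternField J c S t p W)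

omit [NeZero d] [Fact (1 < L)] in
/-- The `p₀`-term of the derivative is the integrand of the marked field. -/
theorem dIntegrandP_eq_sum_coefFieldFn (J : ℕ) (c : ℕ → ℝ) (S : Finset (Plaquette d L)) (t : ℝ)
    (W : GaugeConfig d L SU2) :
    dIntegrandP J c S t W = ∑ p₀ : Plaquette d L, coefFieldFn J (markedField c S t p₀) W := by
  unfold dIntegrandP coefFieldFn
  refine Finset.sum_congr rfl fun p₀ _ => ?_
  rw [← Finset.mul_prod_erase univ _ (Finset.mem_univ p₀), charSum_markedField_self, mul_comm]
  congr 1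
  refine Finset.prod_congr rfl fun p hp => ?_
  have hne : p ≠ p₀ := (Finset.mem_erase.1 hp).1
  unfold markedField
  rw [Function.update_of_ne hne, charSum_patternField]

omit [NeZero d] [Fact (1 < L)] in
/-- Pointwise differentiability of the integrand (product rule). -/
theorem hasDerivAt_lineFnP (J : ℕ) (c : ℕ → ℝ) (S : Finset (Plaquette d L)) (W : GaugeConfig d L SU2) (t : ℝ) :
    HasDerivAt (fun s : ℝ => lineFnP J c S s W) (dIntegrandP J c S t W) t := by
  have h : HasDerivAt (∏ p ∈ (univ : Finset (Plaquette d L)), fun s : ℝ => aP J c S p W + s * bP J c S p W)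
      (∑ p₀ ∈ (univ : Finset (Plaquette d L)), (∏ p ∈ univ.erase p₀, (aP J c S p W + t * bP J c S p W)) •
        bP J c S p₀ W) t :=
    HasDerivAt.finsetProd fun p _ => (hasDerivAt_mul_const _).const_add _
  have hfun : (fun s : ℝ => lineFnP J c S s W) =
      ∏ p ∈ (univ : Finset (Plaquette d L)), fun s : ℝ => aP J c S p W + s * bP J c S p W := by
    funext s
    simp only [lineFnP, Finset.prod_apply]
  rw [hfun]
  unfold dIntegrandP
  simpa only [smul_eq_mul] using h

/-! #### Continuity -/

omit [NeZero d] [NeZero L] [Fact (1 < L)] in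
/-- `aP` is continuous in the configuration. -/
theorem continuous_aP (J : ℕ) (c : ℕ → ℝ) (S : Finset (Plaquette d L)) (p : Plaquette d L) :
    Continuous (aP J c S p) := by
  unfold aP
  split_ifs
  · exact (continuous_fR J c).comp (continuous_plaqRe p)
  · exact continuous_const

omit [NeZero d] [NeZero L] [Fact (1 < L)] in
/-- `bP` is continuous in the configuration. -/
theorem continuous_bP (J : ℕ) (c : ℕ → ℝ) (S : Finset (Plaquette d L)) (p : Plaquette d L) :
    Continuous (bP J c S p) := by
  unfold bP
  split_ifs
  · exact continuous_const
  · exact ((continuous_fR J c).comp (continuous_plaqRe p)).sub continuous_const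

omit [NeZero d] [Fact (1 < L)] in
/-- `lineFnP t` is continuous in the configuration. -/
theorem continuous_lineFnP (J : ℕ) (c : ℕ → ℝ) (S : Finset (Plaquette d L)) (t : ℝ) :
    Continuous (lineFnP J c S t) := by
  unfold lineFnP
  exact continuous_finsetProd _ fun p _ => (continuous_aP J c S p).add (continuous_const.mul (continuous_bP J c S p))

omit [NeZero d] [Fact (1 < L)] in
/-- `(t, W) ↦ dIntegrandP t W` is jointly continuous. -/
theorem continuous_dIntegrandP₂ (J : ℕ) (c : ℕ → ℝ) (S : Finset (Plaquette d L)) :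
    Continuous fun z : ℝ × GaugeConfig d L SU2 => dIntegrandP J c S z.1 z.2 := by
  unfold dIntegrandP
  refine continuous_finsetSum _ fun p₀ _ => ?_
  refine (continuous_finsetProd _ fun p _ => ?_).mul ((continuous_bP J c S p₀).comp continuous_snd)
  exact ((continuous_aP J c S p).comp continuous_snd).add
    (continuous_fst.mul ((continuous_bP J c S p).comp continuous_snd))

omit [NeZero d] [Fact (1 < L)] in
/-- `dIntegrandP t` is continuous in the configuration. -/
theorem continuous_dIntegrandP (J : ℕ) (c : ℕ → ℝ) (S : Finset (Plaquette d L)) (t : ℝ) :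
    Continuous (dIntegrandP J c S t) := by
  unfold dIntegrandP
  refine continuous_finsetSum _ fun p₀ _ => ?_
  refine (continuous_finsetProd _ fun p _ => ?_).mul (continuous_bP J c S p₀)
  exact (continuous_aP J c S p).add (continuous_const.mul (continuous_bP J c S p))

/-! #### Differentiation under the integral sign -/

omit [NeZero d] [Fact (1 < L)] in
/-- **`d/dt Z_S(t) = ∫ dIntegrandP t dU`** (the integrand and its derivative are continuous, hence bounded on the compact
`[t-1, t+1] × SU(2)^{links}`; `hasDerivAt_integral_of_dominated_loc_of_deriv_le`). -/
theorem hasDerivAt_coefFieldZ_pattern (J : ℕ) (c : ℕ → ℝ) (S : Finset (Plaquette d L)) (t₀ : ℝ) :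
    HasDerivAt (fun t => coefFieldZ J (patternField c S t))
      (∫ W, dIntegrandP J c S t₀ W ∂(Measure.pi fun _ : Edge d L => haarProbability SU2)) t₀ := by
  haveI : SecondCountableTopology SU2 := secondCountableTopology_su2
  have hZ : (fun t => coefFieldZ J (patternField c S t)) =
      fun t => ∫ W, lineFnP J c S t W ∂(Measure.pi fun _ : Edge d L => haarProbability SU2) :=
    funext fun t => coefFieldZ_patternField_eq J c S t
  rw [hZ]
  have hK : IsCompact (Metric.closedBall t₀ 1 ×ˢ (Set.univ : Set (GaugeConfig d L SU2))) :=
    (isCompact_closedBall t₀ 1).prod isCompact_univ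
  obtain ⟨K, hKb⟩ := hK.exists_bound_of_continuousOn (continuous_dIntegrandP₂ J c S).continuousOn
  have hbound : ∀ᵐ W ∂(Measure.pi fun _ : Edge d L => haarProbability SU2), ∀ t ∈ Metric.ball t₀ 1,
      ‖dIntegrandP J c S t W‖ ≤ K :=
    ae_of_all _ fun W t ht => hKb (t, W) ⟨Metric.ball_subset_closedBall ht, Set.mem_univ _⟩
  have key := hasDerivAt_integral_of_dominated_loc_of_deriv_le
    (μ := Measure.pi fun _ : Edge d L => haarProbability SU2) (F := lineFnP J c S) (F' := dIntegrandP J c S)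
    (x₀ := t₀) (bound := fun _ => K) (Metric.ball_mem_nhds t₀ one_pos)
    (Filter.Eventually.of_forall fun t => (continuous_lineFnP J c S t).aestronglyMeasurable)
    (integrable_of_continuous_fin (continuous_lineFnP J c S t₀)) ((continuous_dIntegrandP J c S t₀).aestronglyMeasurable)
    hbound (integrable_const K) (ae_of_all _ fun W t _ => hasDerivAt_lineFnP J c S W t)
  exact key.2

omit [NeZero d] [Fact (1 < L)] in
/-- **The derivative is the sum of the marked field partition functions.** -/
theorem integral_dIntegrandP_eq (J : ℕ) (c : ℕ → ℝ) (S : Finset (Plaquette d L)) (t : ℝ) :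
    ∫ W, dIntegrandP J c S t W ∂(Measure.pi fun _ : Edge d L => haarProbability SU2) =
      ∑ p₀ : Plaquette d L, coefFieldZ J (markedField c S t p₀) := by
  haveI : SecondCountableTopology SU2 := secondCountableTopology_su2
  simp_rw [dIntegrandP_eq_sum_coefFieldFn J c S t]
  exact integral_finsetSum _ fun p₀ _ => integrable_of_continuous_fin (continuous_coefFieldFn J _)

/-! ### Positivity of the marked terms by transport and reflection positivity -/

/-- The reflection of a non-crossing plaquette is non-crossing (`L` even). -/
theorem not_isCrossPlaq_plaqReflect (hL : Even L) {q : Plaquette d L} (hq : ¬ IsCrossPlaq q) :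
    ¬ IsCrossPlaq (plaqReflect q) := by
  by_cases hpos : IsPosPlaq q
  · exact ((isNegPlaq_plaqReflect_iff hL q).2 hpos).2
  · have hneg : IsNegPlaq q := ⟨hpos, hq⟩
    have hpos' : IsPosPlaq (plaqReflect q) := by
      have h := (isNegPlaq_plaqReflect_iff hL (plaqReflect q)).1
      rw [plaqReflect_plaqReflect] at h
      exact h hneg
    exact fun hc => not_isPosPlaq_of_isCrossPlaq hL hc hpos'

/-- **Reflection-transportable plaquette sets**: every plaquette `p₀` is carried onto a crossing plaquette by a transposition
`0 ↔ μ` followed by a translation, and the membership in `S` pulled back along that symmetry is invariant under the reflection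
of plaquettes (the cube patterns of `CubePattern` are such: `cubePattern_transport`). [folklore] -/
def IsReflTransportable (S : Finset (Plaquette d L)) : Prop :=
  ∀ p₀ : Plaquette d L, ∃ μ : Fin d, ∃ v : Site d L, IsCrossPlaq (plaqShift v (plaqTranspose 0 μ p₀)) ∧
    ∀ q : Plaquette d L, plaqTranspose 0 μ (plaqShift (-v) (plaqReflect q)) ∈ S ↔ plaqTranspose 0 μ (plaqShift (-v) q) ∈ S

omit [NeZero d] [NeZero L] [Fact (1 < L)] in
/-- `plaqShift (-v)` undoes `plaqShift v`. -/
theorem plaqShift_neg_plaqShift (v : Site d L) (p : Plaquette d L) : plaqShift (-v) (plaqShift v p) = p := by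
  obtain ⟨x, q⟩ := p
  simp [plaqShift]

omit [NeZero d] [NeZero L] [Fact (1 < L)] in
/-- `plaqShift v` undoes `plaqShift (-v)`. -/
theorem plaqShift_plaqShift_neg (v : Site d L) (p : Plaquette d L) : plaqShift v (plaqShift (-v) p) = p := by
  obtain ⟨x, q⟩ := p
  simp [plaqShift]

omit [NeZero d] [NeZero L] [Fact (1 < L)] in
/-- `plaqTranspose` is an involution. -/
theorem plaqTranspose_plaqTranspose' (μ ν : Fin d) (p : Plaquette d L) :
    plaqTranspose μ ν (plaqTranspose μ ν p) = p :=
  (plaqTransposeEquiv (L := L) μ ν).left_inv p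

omit [Fact (1 < L)] in
/-- Transport of a field partition function: `Z(a) = Z(a ∘ σ⁻¹)` for `σ = (shift v) ∘ (transpose 0 μ)`. -/
theorem coefFieldZ_transport (J : ℕ) (a : Plaquette d L → ℕ → ℝ) (μ : Fin d) (v : Site d L) :
    coefFieldZ J a = coefFieldZ J (fun q => a (plaqTranspose 0 μ (plaqShift (-v) q))) := by
  rw [← coefFieldZ_comp_plaqTranspose J a 0 μ,
    ← coefFieldZ_comp_plaqShift J (fun q => a (plaqTranspose 0 μ (plaqShift (-v) q))) v]
  simp only [plaqShift_neg_plaqShift]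

/-- **Every marked term is non-negative** (`t ≥ 0`, `c_j ≥ 0`, `S` reflection-transportable): on `S` the marked factor
vanishes; off `S` the marked plaquette is transported to the reflection hyperplane, where the transported field is
mirror-symmetric off the crossing plaquettes and non-negative, so `FieldRP.coefFieldZ_nonneg` applies. -/
theorem coefFieldZ_marked_nonneg (hL : Even L) (J : ℕ) {c : ℕ → ℝ} (hc : ∀ n, 1 ≤ n → 0 ≤ c n)
    {S : Finset (Plaquette d L)} (hS : IsReflTransportable S) {t : ℝ} (ht : 0 ≤ t) (p₀ : Plaquette d L) :
    0 ≤ coefFieldZ J (markedField c S t p₀) := by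
  by_cases hp₀ : p₀ ∈ S
  · refine le_of_eq (coefFieldZ_eq_zero_of_apply_eq_zero J (p₀ := p₀) ?_).symm
    simp [markedField, hp₀]
  obtain ⟨μ, v, hcross, hrefl⟩ := hS p₀
  rw [coefFieldZ_transport J _ μ v]
  -- non-negativity of all coefficient vectors involved
  have hstd : ∀ n, 0 ≤ stdCoef c n := stdCoef_nonneg hc
  have hstdt : ∀ n, 0 ≤ stdCoef (scaleCoeff t c) n :=
    stdCoef_nonneg fun n hn => mul_nonneg ht (hc n hn)
  have hpat : ∀ q n, 0 ≤ patternField c S t q n := fun q n => by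
    unfold patternField; split_ifs; exacts [hstd n, hstdt n]
  have hmk : ∀ q n, 0 ≤ markedField c S t p₀ q n := fun q n => by
    unfold markedField
    by_cases hq : q = p₀
    · subst hq; rw [Function.update_self, if_neg hp₀]; exact gCoef_nonneg hc n
    · rw [Function.update_of_ne hq]; exact hpat q n
  -- the inverse transport hits `p₀` only at the crossing plaquette `σ p₀`
  have hinv : ∀ q : Plaquette d L, plaqTranspose 0 μ (plaqShift (-v) q) = p₀ →
      q = plaqShift v (plaqTranspose 0 μ p₀) := fun q h => by
    rw [← h, plaqTranspose_plaqTranspose', plaqShift_plaqShift_neg]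
  refine coefFieldZ_nonneg hL J (fun q hq => ?_) (fun q _ n => hmk _ n)
  have hq' : ¬ IsCrossPlaq (plaqReflect q) := not_isCrossPlaq_plaqReflect hL hq
  have hne : plaqTranspose 0 μ (plaqShift (-v) q) ≠ p₀ := fun h => hq (by rw [hinv q h]; exact hcross)
  have hne' : plaqTranspose 0 μ (plaqShift (-v) (plaqReflect q)) ≠ p₀ := fun h =>
    hq' (by rw [hinv _ h]; exact hcross)
  simp only [markedField, Function.update_of_ne hne, Function.update_of_ne hne', patternField, hrefl q]

/-! ### Monotonicity in `t` and the comparison `Z_S(0) ≤ Z_Λ` -/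

/-- **`Z_S(t)` is non-decreasing on `t ≥ 0`.** -/
theorem monotoneOn_coefFieldZ_pattern (hL : Even L) (J : ℕ) {c : ℕ → ℝ} (hc : ∀ n, 1 ≤ n → 0 ≤ c n)
    {S : Finset (Plaquette d L)} (hS : IsReflTransportable S) :
    MonotoneOn (fun t => coefFieldZ J (patternField c S t)) (Set.Ici 0) := by
  have hderiv : ∀ s, HasDerivAt (fun t => coefFieldZ J (patternField c S t))
      (∫ W, dIntegrandP J c S s W ∂(Measure.pi fun _ : Edge d L => haarProbability SU2)) s :=
    fun s => hasDerivAt_coefFieldZ_pattern J c S s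
  refine monotoneOn_of_deriv_nonneg (convex_Ici 0) ?_ ?_ ?_
  · exact HasDerivAt.continuousOn fun s _ => hderiv s
  · exact fun s _ => (hderiv s).differentiableAt.differentiableWithinAt
  · intro s hs
    rw [interior_Ici] at hs
    rw [(hderiv s).deriv, integral_dIntegrandP_eq J c S s]
    exact Finset.sum_nonneg fun p₀ _ => coefFieldZ_marked_nonneg hL J hc hS (le_of_lt hs) p₀

/-- **Dropping the plaquettes outside a reflection-transportable pattern does not increase the partition function**
(Tomboulis's App. A §1 dropping step, every even torus, every spin cut-off): for `c_j ≥ 0`,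
`∫ ∏_{p ∈ S} f_c(U_p) dU ≤ Z_Λ({c_j})`. -/
theorem coefFieldZ_pattern_le_torusZ (hL : Even L) (J : ℕ) {c : ℕ → ℝ} (hc : ∀ n, 1 ≤ n → 0 ≤ c n)
    {S : Finset (Plaquette d L)} (hS : IsReflTransportable S) :
    coefFieldZ J (basePatternField c S) ≤ torusZ d L J c := by
  rw [← patternField_zero, ← coefFieldZ_patternField_one J c S]
  exact monotoneOn_coefFieldZ_pattern hL J hc hS (Set.mem_Ici.2 le_rfl) (Set.mem_Ici.2 zero_le_one) zero_le_one

end Marked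

end Summit.Ventures.YMGap.Census

end
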